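import Literature.AnabelianGeometry.EtaleTheta.ThetaSystemsToyTower
import Literature.AnabelianGeometry.EtaleTheta.Discharge.Sec2EnvelopeLemmas
import Literature.AnabelianGeometry.EtaleTheta.Discharge.Sec2IsoLift
import HarnessLib

/-!
# An inversion-twisted inhabitant of the [EtTh] §2 tower interface `ThetaEnvTower E`
# (part 1 of 3 of: the tower form of Cor. 2.19 (ii) is a SCHEMA — its universal closure is false)

`ThetaSystems.lean` (cell `abc-iut`, seat abc-iut-L2-t2) types S. Mochizuki, *The Étale Theta Function …*
[EtTh] §2, Cor. 2.19 (ii) "Discrete Rigidity" (PRIMS text p. 64: "any projective system of mono-theta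
environments is isomorphic to the natural one") as the `Prop`-valued definition `ThetaEnvTower.Cor219_ii`
over the interface `ThetaEnvTower E` (the level data `ThetaEnvData` at every `M ∈ E` + reductions), which
records the DATA named in print with its bookkeeping axioms but none of the anabelian content (no
temperedness, no slimness, `Π^tp_X` an arbitrary topological group).  In print the statement rests on
Cor. 2.18 (iv) (the groups `Aut(M_M)` are FINITE extensions of one another, so the relevant `R¹lim`
vanishes: "the `R¹lim`'s of `{Hom(ℤ/2ℤ, ℤ/Nℤ)}` and `{μ_N}` vanish", p. 66).  Over the lawless interface
the automorphism groups of the models can be infinite discrete with a non-Mittag-Leffler tower inside,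
and then the `R¹lim ≠ 0` of Rmk. 2.16.1 (iii) (`ThetaEnvTower.exists_compatible_family_not_integral`,
PROVED in `ThetaSystems.lean`) produces a projective system that is NOT isomorphic to the natural one.
This file builds the tower where that happens; `ThetaSystemsInvToyIso.lean` shows that its "shears"
are automorphisms of the model mono-theta environments and builds the twisted system;
`ThetaSystemsInvToyCor219ii.lean` derives the contradiction (`InvToy.not_forall_cor219_ii`).

* `ThetaEnvTower.InvToy.toy` — for ANY admissible index set `E`: `Π^tp_X := ℤ³` (coordinates
  `(x, (y, z))`, discrete abelian, the `Toy.*` vocabulary of `ThetaSystemsToyTower.lean`), `G_K := ℤ` with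
  augmentation the `y`-coordinate, `Π^tp_Y := {x = 0}`, `Π^tp_Ÿ := {x = 0, y even}`, `μ_M := ℤ/M` with the
  residue maps, and the cyclotomic characters `χ_M(t) := inv^t` (`InvToy.chi`): `Π^tp_Y` acts on `μ_M` by
  INVERSION through the parity of `y` (so `Π^tp_Y[μ_M] = μ_M ⋊ Π^tp_Y` is a genuinely non-abelian,
  infinite-dihedral-like group), `Π^tp_Ÿ` acts trivially; the single theta cocycle at level `M` is
  `η_M(0, y, z) = z (mod M)`.  Every interface axiom holds (`InvToy.nonempty_thetaEnvTower`).
* `InvToy.shear r`, `shearY r`, `shearYdd r`, `envShear n r`, `envShearC n r` — the shears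
  `(x, y, z) ↦ (x, y, z + r·y)` of `Π^tp_X`, `Π^tp_Y`, `Π^tp_Ÿ` and `(a, g) ↦ (a, shear_r g)` of
  `Π^tp_Y[μ_n]` (a bi-continuous automorphism: the shear does not move the `y`-coordinate through which
  `Π^tp_Y` acts).  WHY INVERSION: an automorphism of the model `M_M` lying over the shear by `r` must
  satisfy `M ∣ 2r` (part 3), because the inversion kills the `μ_M`-valued cocycles of `Π^tp_Y` in the
  `z`-direction that would otherwise absorb the shear — so `{Aut(M_M)}_M` contains the tower `{(M/2)·ℤ}_M`,
  whose `R¹lim` is `≠ 0`.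

What this construction MEANS: only that the interface row is a schema (FACT-LIST row F-0649 is
consumable AT A NAMED INSTANCE — the model tower `DoubleUnderline.thetaEnvTower`, via
`cor219_ii_of_levels` / `DoubleUnderline.cor219_ii_model_of_facts` — never as `∀ T`); nothing about
[EtTh] (a refereed paper, where `Aut(M_M)` is finite over `Aut(Π^tp_Y)` by Cor. 2.18 (iv)).  Written by
the cell `abc-iut` (seat abc-iut-w5-d071, F-TRANCHES 154 of D-0078 (S1), float after abc-iut-f-154's
census).  No bearing on [IUTchIII] Cor. 3.12; no side taken; typed ≠ proved.  No instances, no notation.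

## References

* [MochizukiEtTh2009] S. Mochizuki, *The étale theta function and its Frobenioid-theoretic
  manifestations*, Publ. RIMS 45 (2009): Def. 2.10 p.44, Def. 2.13 pp.47–48, Rmk. 2.16.1 (iii) p.56,
  Cor. 2.18 (iv) pp.61–63, Cor. 2.19 (ii) p.64, proof p.66 (PRIMS text pages).
-/

namespace Literature.AnabelianGeometry.EtaleTheta

namespace ThetaEnvTower

namespace InvToy

open Toy CycEnvelope

/-! ## §1. The inversion character `χ_n : ℤ → Aut(μ_n)`, `t ↦ (a ↦ a^{(-1)^t})` -/

/-- Inversion `a ↦ a⁻¹` of `μ_n = ℤ/n`, as an automorphism. [cite: MochizukiEtTh2009, Def 2.10 p.44] -/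
abbrev inv (n : ℕ+) : MulAut (Mu n) := MulEquiv.inv (Mu n)

/-- `inv² = 1`. [cite: MochizukiEtTh2009, Def 2.10 p.44] -/
theorem inv_zpow_two (n : ℕ+) : (inv n) ^ (2 : ℤ) = 1 := by
  refine MulEquiv.ext fun a => ?_
  rw [zpow_two, MulAut.mul_apply, MulAut.one_apply, MulEquiv.inv_apply, MulEquiv.inv_apply, inv_inv]

/-- The toy cyclotomic character `χ_n : ℤ → Aut(μ_n)`, `t ↦ inv^t` (the generator of
`Π^tp_X/Π^tp_Ÿ·… ` acts on `μ_n` by inversion). [cite: MochizukiEtTh2009, Def 2.10 p.44] -/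
def chi (n : ℕ+) : Zm →* MulAut (Mu n) := zpowersHom (MulAut (Mu n)) (inv n)

/-- `χ_n(t) = inv^t`. [cite: MochizukiEtTh2009, Def 2.10 p.44] -/
theorem chi_apply (n : ℕ+) (t : Zm) : chi n t = (inv n) ^ (Multiplicative.toAdd t) := rfl

/-- `χ_n(t) = 1` for `t` even. [cite: MochizukiEtTh2009, Def 2.10 p.44] -/
theorem chi_ofAdd_of_even (n : ℕ+) {t : ℤ} (ht : Even t) : chi n (Multiplicative.ofAdd t) = 1 := by
  obtain ⟨k, rfl⟩ := ht
  rw [chi_apply, toAdd_ofAdd, ← two_mul, zpow_mul, inv_zpow_two, one_zpow]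

/-- `χ_n(t) = inv` for `t` odd. [cite: MochizukiEtTh2009, Def 2.10 p.44] -/
theorem chi_ofAdd_of_odd (n : ℕ+) {t : ℤ} (ht : Odd t) : chi n (Multiplicative.ofAdd t) = inv n := by
  obtain ⟨k, rfl⟩ := ht
  rw [chi_apply, toAdd_ofAdd, zpow_add, zpow_mul, inv_zpow_two, one_zpow, one_mul, zpow_one]

/-- `χ_n(t) ∈ {1, inv}`. [cite: MochizukiEtTh2009, Def 2.10 p.44] -/
theorem chi_eq_one_or (n : ℕ+) (t : Zm) : chi n t = 1 ∨ chi n t = inv n := by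
  rcases Int.even_or_odd (Multiplicative.toAdd t) with h | h
  · exact Or.inl (by rw [← ofAdd_toAdd t]; exact chi_ofAdd_of_even n h)
  · exact Or.inr (by rw [← ofAdd_toAdd t]; exact chi_ofAdd_of_odd n h)

/-- The reductions commute with the characters. [cite: MochizukiEtTh2009, Def 2.13(ii) p.48] -/
theorem redMu_chi (n n' : ℕ+) (h : (n : ℕ) ∣ n') (t : Zm) (a : Mu n') :
    redMu n n' h (chi n' t a) = chi n t (redMu n n' h a) := by
  rcases Int.even_or_odd (Multiplicative.toAdd t) with ht | ht
  · rw [← ofAdd_toAdd t, chi_ofAdd_of_even n' ht, chi_ofAdd_of_even n ht, MulAut.one_apply,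
      MulAut.one_apply]
  · rw [← ofAdd_toAdd t, chi_ofAdd_of_odd n' ht, chi_ofAdd_of_odd n ht, MulEquiv.inv_apply,
      MulEquiv.inv_apply, map_inv]

/-- `Π^tp_Ÿ = {x = 0, y even}` acts trivially on every `μ_n`. [cite: MochizukiEtTh2009, Def 2.13 p.47] -/
theorem chi_py_eq_one {g : P} (hg : g ∈ PiYdd0) (n : ℕ+) : chi n (py g) = 1 := by
  obtain ⟨x, y, z⟩ := g
  rw [mem_PiYdd0_iff, ZMod.intCast_zmod_eq_zero_iff_dvd] at hg
  obtain ⟨k, hk⟩ := hg.1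
  have hk' : Multiplicative.toAdd y = 2 * k := by exact_mod_cast hk
  have : py (x, (y, z)) = Multiplicative.ofAdd (2 * k) := by
    rw [← hk']; rfl
  rw [this]
  exact chi_ofAdd_of_even n (even_two_mul k)

/-! ## §2. The toy theta cocycles `η_n(0, y, z) = z (mod n)` -/

/-- THE toy theta cocycle at level `n`: `Π^tp_Ÿ → μ_n`, `(0, y, z) ↦ z (mod n)`.
[cite: MochizukiEtTh2009, Def 2.13 p.47] -/
def eta (n : ℕ+) : PiYdd0 → Mu n := fun g => castM n (pz (g : P))

/-- `η_n` evaluated. [cite: MochizukiEtTh2009, Def 2.13 p.47] -/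
theorem eta_apply (n : ℕ+) (g : PiYdd0) : eta n g = castM n (pz (g : P)) := rfl

/-- `redMu ∘ η_{n'} = η_n`. [cite: MochizukiEtTh2009, Def 2.13(ii) p.48] -/
theorem redMu_eta (n n' : ℕ+) (h : (n : ℕ) ∣ n') (g : PiYdd0) : redMu n n' h (eta n' g) = eta n g :=
  redMu_castM n n' h _

/-! ## §3. The inversion-twisted toy tower -/

variable {E : Set ℕ+}

/-- **The inversion-twisted toy `ThetaEnvTower E`** over any admissible index set `E`:
`Π^tp_X = ℤ³` (discrete abelian, coordinates `(x, (y, z))`), `G_K := ℤ` with augmentation the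
`y`-coordinate, `Π^tp_Y = {x = 0}`, `Π^tp_Ÿ = {x = 0, y even}`, `(l·Δ_Θ)` = the `z`-axis, `μ_M = ℤ/M`
with the residue maps, cyclotomic characters `χ_M(t) = inv^t` (so `Π^tp_Y` acts on `μ_M` by
INVERSION through the parity of `y`, and `Π^tp_Ÿ` acts trivially), and at each level the single
theta cocycle `η_M(0, y, z) = z`. Every interface axiom holds. [cite: MochizukiEtTh2009, Cor 2.19(ii) p.64] -/
@[reducible] noncomputable def toy (h1 : (1 : ℕ+) ∈ E) (hcof : ∀ n : ℕ+, ∃ M ∈ E, n ∣ M)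
    (htot : ∀ M ∈ E, ∀ M' ∈ E, M ∣ M' ∨ M' ∣ M) : ThetaEnvTower.{0} E where
  one_mem := h1
  cofinal := hcof
  total := htot
  PiX := P
  G := Zm
  aug := py
  aug_surjective := fun t => ⟨(1, (t, 1)), rfl⟩
  PiY := PiY0
  PiY_normal := inferInstance
  PiY_open := isOpen_discrete _
  galYX := QuotientGroup.quotientKerEquivOfSurjective px (fun z => ⟨(z, 1), rfl⟩)
  PiYdd := PiYdd0
  PiYdd_le := inf_le_right
  PiYdd_normal := inferInstance
  PiYdd_open := isOpen_discrete _
  index_PiYdd := index_PiYdd0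
  mu := fun M => Mu M
  mu_cyclic := fun _ => inferInstance
  card_mu := fun M => by rw [Fintype.card_multiplicative, ZMod.card]
  chi := fun M => chi M
  chi_ker_open := fun _ => isOpen_discrete _
  thetaCocycles := fun M => {eta M}
  thetaCocycles_nonempty := fun _ => Set.singleton_nonempty _
  isCocycle := fun M η hη g h => by
    rw [Set.mem_singleton_iff] at hη
    subst hη
    rw [MonoidHom.comp_apply, Subgroup.subtype_apply, chi_py_eq_one g.2, MulAut.one_apply]
    exact map_mul ((castM M).comp pz) (g : P) (h : P)
  locallyConstant := fun M η _ => IsLocallyConstant.of_discrete η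
  mul_coboundary_mem := fun M η hη c => by
    rw [Set.mem_singleton_iff] at hη ⊢
    subst hη
    funext g
    rw [Pi.mul_apply, CycEnvelope.coboundary, MonoidHom.comp_apply, Subgroup.subtype_apply,
      chi_py_eq_one g.2, MulAut.one_apply, mul_inv_cancel, mul_one]
  red := fun M M' h => redMu M M' (PNat.dvd_iff.1 h)
  red_surjective := fun M M' h => redMu_surjective _ _ _
  red_self := fun M h a => redMu_self _ _ a
  red_comp := fun M M' M'' h h' a => redMu_comp _ _ _ (PNat.dvd_iff.1 h) (PNat.dvd_iff.1 h') a
  red_chi := fun M M' h g a => redMu_chi _ _ _ g a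
  red_cocycle_mem := fun M M' h η hη => by
    rw [Set.mem_singleton_iff] at hη ⊢
    subst hη
    funext g
    exact redMu_eta _ _ _ g
  red_cocycle_surj := fun M M' h η hη => by
    rw [Set.mem_singleton_iff] at hη
    subst hη
    exact ⟨eta M', rfl, funext fun g => redMu_eta _ _ _ g⟩
  lDeltaTheta := L0
  thetaMod := fun M => (castM M).comp (pz.comp L0.subtype)
  thetaMod_surjective := fun M a => by
    obtain ⟨m, hm⟩ := ZMod.intCast_surjective (Multiplicative.toAdd a)
    refine ⟨⟨(1, (1, Multiplicative.ofAdd m)), (mem_L0_iff _ _ _).2 ⟨rfl, rfl⟩⟩, ?_⟩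
    rw [MonoidHom.comp_apply, MonoidHom.comp_apply, castM_apply]
    change Multiplicative.ofAdd (((Multiplicative.toAdd (Multiplicative.ofAdd m) : ℤ)) : ZMod M) = a
    rw [toAdd_ofAdd, hm, ofAdd_toAdd]
  red_thetaMod := fun M M' h g => redMu_castM _ _ _ _

/-- The tower interface is inhabited by the inversion-twisted toy over the factorial levels.
[cite: MochizukiEtTh2009, Cor 2.19(ii) p.64] -/
theorem nonempty_thetaEnvTower : Nonempty (ThetaEnvTower.{0} facLevels) :=
  ⟨toy one_mem_facLevels facLevels_cofinal facLevels_total⟩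

/-! ## §4. The shears `(x, y, z) ↦ (x, y, z + r·y)` of `Π^tp_X`, `Π^tp_Y`, `Π^tp_Ÿ` -/

/-- The shear `(x, y, z) ↦ (x, y, z·y^r)` of `Π^tp_X = ℤ³` (written multiplicatively).
[cite: MochizukiEtTh2009, Cor 2.19(ii) p.64] -/
def shear (r : ℤ) : P ≃* P where
  toFun g := (g.1, (g.2.1, g.2.2 * g.2.1 ^ r))
  invFun g := (g.1, (g.2.1, g.2.2 * g.2.1 ^ (-r)))
  left_inv g := by
    obtain ⟨x, y, z⟩ := g
    simp only [zpow_neg, mul_inv_cancel_right]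
  right_inv g := by
    obtain ⟨x, y, z⟩ := g
    simp only [zpow_neg, inv_mul_cancel_right]
  map_mul' g h := by
    obtain ⟨x, y, z⟩ := g
    obtain ⟨x', y', z'⟩ := h
    simp only [Prod.mk_mul_mk, mul_zpow, Prod.mk.injEq, true_and]
    rw [mul_mul_mul_comm]

/-- The shear on a tuple. [cite: MochizukiEtTh2009, Cor 2.19(ii) p.64] -/
@[simp] theorem shear_apply (r : ℤ) (x y z : Zm) : shear r (x, (y, z)) = (x, (y, z * y ^ r)) := rfl

/-- The shear fixes the `x`-coordinate. [cite: MochizukiEtTh2009, Cor 2.19(ii) p.64] -/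
theorem px_shear (r : ℤ) (g : P) : px (shear r g) = px g := rfl

/-- The shear fixes the `y`-coordinate. [cite: MochizukiEtTh2009, Cor 2.19(ii) p.64] -/
theorem py_shear (r : ℤ) (g : P) : py (shear r g) = py g := rfl

/-- The `z`-coordinate of the shear. [cite: MochizukiEtTh2009, Cor 2.19(ii) p.64] -/
theorem pz_shear (r : ℤ) (g : P) : pz (shear r g) = pz g * py g ^ r := rfl

/-- Shears compose additively. [cite: MochizukiEtTh2009, Cor 2.19(ii) p.64] -/
theorem shear_shear (r s : ℤ) (g : P) : shear r (shear s g) = shear (s + r) g := by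
  obtain ⟨x, y, z⟩ := g
  simp only [shear_apply, zpow_add, mul_assoc]

/-- The trivial shear. [cite: MochizukiEtTh2009, Cor 2.19(ii) p.64] -/
theorem shear_zero (g : P) : shear 0 g = g := by
  obtain ⟨x, y, z⟩ := g
  simp only [shear_apply, zpow_zero, mul_one]

/-- The shear stabilises `Π^tp_Y = {x = 0}`. [cite: MochizukiEtTh2009, Cor 2.19(ii) p.64] -/
theorem shear_mem_PiY0 (r : ℤ) {g : P} (hg : g ∈ PiY0) : shear r g ∈ PiY0 := by
  rw [mem_PiY0_iff] at hg ⊢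
  exact hg

/-- The shear stabilises `Π^tp_Ÿ = {x = 0, y even}`. [cite: MochizukiEtTh2009, Cor 2.19(ii) p.64] -/
theorem shear_mem_PiYdd0 (r : ℤ) {g : P} (hg : g ∈ PiYdd0) : shear r g ∈ PiYdd0 := by
  obtain ⟨x, y, z⟩ := g
  rw [shear_apply, mem_PiYdd0_iff]
  exact (mem_PiYdd0_iff x y z).1 hg

/-- The shear restricted to `Π^tp_Y`. [cite: MochizukiEtTh2009, Cor 2.19(ii) p.64] -/
def shearY (r : ℤ) : PiY0 ≃* PiY0 where
  toFun g := ⟨shear r g, shear_mem_PiY0 r g.2⟩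
  invFun g := ⟨shear (-r) g, shear_mem_PiY0 (-r) g.2⟩
  left_inv g := Subtype.ext (by
    change shear (-r) (shear r (g : P)) = g
    rw [shear_shear, add_neg_cancel, shear_zero])
  right_inv g := Subtype.ext (by
    change shear r (shear (-r) (g : P)) = g
    rw [shear_shear, neg_add_cancel, shear_zero])
  map_mul' g h := Subtype.ext (map_mul (shear r) (g : P) (h : P))

/-- `shearY` on underlying elements. [cite: MochizukiEtTh2009, Cor 2.19(ii) p.64] -/
@[simp] theorem coe_shearY (r : ℤ) (g : PiY0) : ((shearY r g : PiY0) : P) = shear r g := rfl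

/-- The shear restricted to `Π^tp_Ÿ`. [cite: MochizukiEtTh2009, Cor 2.19(ii) p.64] -/
def shearYdd (r : ℤ) : PiYdd0 ≃* PiYdd0 where
  toFun g := ⟨shear r g, shear_mem_PiYdd0 r g.2⟩
  invFun g := ⟨shear (-r) g, shear_mem_PiYdd0 (-r) g.2⟩
  left_inv g := Subtype.ext (by
    change shear (-r) (shear r (g : P)) = g
    rw [shear_shear, add_neg_cancel, shear_zero])
  right_inv g := Subtype.ext (by
    change shear r (shear (-r) (g : P)) = g
    rw [shear_shear, neg_add_cancel, shear_zero])
  map_mul' g h := Subtype.ext (map_mul (shear r) (g : P) (h : P))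

/-- `shearYdd` on underlying elements. [cite: MochizukiEtTh2009, Cor 2.19(ii) p.64] -/
@[simp] theorem coe_shearYdd (r : ℤ) (g : PiYdd0) : ((shearYdd r g : PiYdd0) : P) = shear r g := rfl

/-! ## §5. The envelope `Π^tp_Y[μ_n] = μ_n ⋊ Π^tp_Y` of the toy and its shears -/

/-- The augmentation of `Π^tp_Y` (the `y`-coordinate). [cite: MochizukiEtTh2009, Def 2.13 p.47] -/
abbrev augY0 : PiY0 →* Zm := py.comp PiY0.subtype

/-- `Π^tp_Y[μ_n]` for the toy: `μ_n ⋊ Π^tp_Y`, `Π^tp_Y` acting by `χ_n ∘ y`. [cite: MochizukiEtTh2009, Def 2.13(ii) p.47] -/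
abbrev Env (n : ℕ+) : Type := CycEnvelope augY0 (chi n)

/-- The level-`M` envelope of the toy tower IS `Env M` (definitionally).
[cite: MochizukiEtTh2009, Def 2.13(ii) p.47] -/
theorem level_env_eq (h1 : (1 : ℕ+) ∈ E) (hcof : ∀ n : ℕ+, ∃ M ∈ E, n ∣ M)
    (htot : ∀ M ∈ E, ∀ M' ∈ E, M ∣ M' ∨ M' ∣ M) (M : E) :
    ((toy h1 hcof htot).level M).env = Env M := rfl

/-- `Π^tp_Y[μ_n]` is discrete. [cite: MochizukiEtTh2009, Def 2.13(ii) p.47] -/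
theorem discreteTopology_env (n : ℕ+) : DiscreteTopology (Env n) :=
  DiscreteTopology.of_continuous_injective
    (f := fun x : Env n => (x.left, x.right)) continuous_induced_dom
    (fun _ _ h => SemidirectProduct.ext (Prod.mk.inj h).1 (Prod.mk.inj h).2)

/-- The shear `(a, g) ↦ (a, shear_r g)` of `Π^tp_Y[μ_n]` (identity on the cyclotome; a homomorphism
because the shear does not change the `y`-coordinate through which `Π^tp_Y` acts).
[cite: MochizukiEtTh2009, Cor 2.19(ii) p.64] -/
def envShear (n : ℕ+) (r : ℤ) : Env n ≃* Env n :=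
  SemidirectProduct.congr (MulEquiv.refl (Mu n)) (shearY r) (fun _ => MulEquiv.ext fun _ => rfl)

/-- `envShear` in coordinates. [cite: MochizukiEtTh2009, Cor 2.19(ii) p.64] -/
@[simp] theorem envShear_apply (n : ℕ+) (r : ℤ) (x : Env n) :
    envShear n r x = ⟨x.left, shearY r x.right⟩ := rfl

/-- `envShear⁻¹` in coordinates. [cite: MochizukiEtTh2009, Cor 2.19(ii) p.64] -/
@[simp] theorem envShear_symm_apply (n : ℕ+) (r : ℤ) (x : Env n) :
    (envShear n r).symm x = ⟨x.left, (shearY r).symm x.right⟩ := rfl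

/-- The shear of `Π^tp_Y[μ_n]` as an automorphism of the (discrete) topological group.
[cite: MochizukiEtTh2009, Cor 2.19(ii) p.64] -/
def envShearC (n : ℕ+) (r : ℤ) : Env n ≃ₜ* Env n :=
  haveI := discreteTopology_env n
  { envShear n r with
    continuous_toFun := continuous_of_discreteTopology
    continuous_invFun := continuous_of_discreteTopology }

/-- `envShearC` is `envShear`. [cite: MochizukiEtTh2009, Cor 2.19(ii) p.64] -/
@[simp] theorem envShearC_toMulEquiv (n : ℕ+) (r : ℤ) : (envShearC n r).toMulEquiv = envShear n r := rfl

/-- `envShearC` applied. [cite: MochizukiEtTh2009, Cor 2.19(ii) p.64] -/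
@[simp] theorem envShearC_apply (n : ℕ+) (r : ℤ) (x : Env n) : envShearC n r x = envShear n r x := rfl

/-- `envShearC⁻¹` applied. [cite: MochizukiEtTh2009, Cor 2.19(ii) p.64] -/
@[simp] theorem envShearC_symm_apply (n : ℕ+) (r : ℤ) (x : Env n) :
    (envShearC n r).symm x = (envShear n r).symm x := rfl

end InvToy

end ThetaEnvTower

end Literature.AnabelianGeometry.EtaleTheta
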